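import Mathlib
import Literature.Probability.LatticeModels.GKSInequalities
import Summits.CriticalPhenomena.Ising3DConformalLimit.Theorems.PrecisionLaplacianInverseMFerromagnetImNonadjOfLaw2Aux
import Summits.CriticalPhenomena.Ising3DConformalLimit.Theorems.PrecisionLaplacianInverseMFerromagnetSpSubdivideAux
import Summits.CriticalPhenomena.Ising3DConformalLimit.Theorems.PrecisionLaplacianInverseMFerromagnetSpPendant
import HarnessLib

/-!
# Crux `PrecisionLaplacian.InverseMFerromagnet` (stmt-CriticalPhenomena-4798), line `Sketch` —
# auxiliary lemmas (part 2, bookkeeping of the subdivided structure) for stub `helper_sp_subdivide`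

THEOREM-ONLY helper file (no definitions).  The SUBDIVIDED STRUCTURE: old sites `Fin n` embedded
by `Fin.castSucc`, new site `ℓ = Fin.last n`; the old bond `i₀ = {a, b}` becomes
`C' i₀.castSucc = {a', ℓ}` (`a' = a.castSucc`), the new bond is `C' (Fin.last m) = {ℓ, b'}`, every
other old bond `i` keeps its support `(C i).map Fin.castSuccEmb`.  This file proves:

* the case analysis of the bonds (`spSub_bond_cases`; `spPend_map_pair`, `spPend_last_not_mem_map`
  are reused from the pendant step), every bond lies in the old sites
  `A = univ.erase ℓ` or in `B = insert a' (insert b' Aᶜ) = {a', b', ℓ}` (`spSub_sides`), the bonds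
  inside `B` are `{a',b'}`, `{a',ℓ}` or `{ℓ,b'}` (`spSub_bond_in_B`), cardinalities;
* the total couplings of the new structure on the pairs `{p', q'}` (old), `{a', ℓ}`, `{ℓ, b'}`
  (`spSub_coupling_old/_al/_lb`) and of the old structure with the SERIES COUPLING `K''` on `i₀`
  (`spSub_coupling_Kvec`);
* **the marginal identity** (`spSub_marginal`): summing out `σ_ℓ`
  (`∑_{τ=±1} e^{τ(uσ_a + wσ_b)} = 2 cosh (uσ_a + wσ_b) ∝ e^{K''σ_aσ_b}`,
  `K'' = ½ log (cosh (u+w)/cosh (u−w))`), the law of the old spins under the subdivided system with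
  couplings `K'` is the OLD system with couplings `K' ∘ castSucc` off `i₀` and `K''` on `i₀`.
-/

namespace Summit.CriticalPhenomena.Ising3DConformalLimit.Cruxes.InverseMFerromagnet.PartialCovarianceLadder

open Literature.Probability.LatticeModels Finset Matrix

/-! ## Supports of the subdivided structure -/

/-- **The bonds of the subdivided structure**: an embedded old bond `≠ i₀`, the bond
`{a', ℓ}` (index `i₀.castSucc`), or the new bond `{ℓ, b'}` (index `Fin.last m`). [folklore] -/
theorem spSub_bond_cases {n m : ℕ} (C : Fin m → Finset (Fin n)) (i₀ : Fin m) (a b : Fin n)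
    (C' : Fin (m + 1) → Finset (Fin (n + 1)))
    (hC'1 : ∀ i : Fin m, i ≠ i₀ → C' i.castSucc = (C i).map Fin.castSuccEmb)
    (hC'2 : C' i₀.castSucc = {a.castSucc, Fin.last n})
    (hC'3 : C' (Fin.last m) = {Fin.last n, b.castSucc}) (j : Fin (m + 1)) :
    (∃ i : Fin m, i ≠ i₀ ∧ j = i.castSucc ∧ C' j = (C i).map Fin.castSuccEmb) ∨
      (j = i₀.castSucc ∧ C' j = {a.castSucc, Fin.last n}) ∨
      (j = Fin.last m ∧ C' j = {Fin.last n, b.castSucc}) := by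
  induction j using Fin.lastCases with
  | last => exact Or.inr (Or.inr ⟨rfl, hC'3⟩)
  | cast i =>
    by_cases hi : i = i₀
    · subst hi
      exact Or.inr (Or.inl ⟨rfl, hC'2⟩)
    · exact Or.inl ⟨i, hi, rfl, hC'1 i hi⟩

/-- Every bond of the subdivided structure has two sites. [folklore] -/
theorem spSub_card {n m : ℕ} (C : Fin m → Finset (Fin n)) (hC : ∀ i, (C i).card = 2) (i₀ : Fin m)
    (a b : Fin n) (C' : Fin (m + 1) → Finset (Fin (n + 1)))
    (hC'1 : ∀ i : Fin m, i ≠ i₀ → C' i.castSucc = (C i).map Fin.castSuccEmb)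
    (hC'2 : C' i₀.castSucc = {a.castSucc, Fin.last n})
    (hC'3 : C' (Fin.last m) = {Fin.last n, b.castSucc}) (j : Fin (m + 1)) : (C' j).card = 2 := by
  rcases spSub_bond_cases C i₀ a b C' hC'1 hC'2 hC'3 j with ⟨i, -, -, h⟩ | ⟨-, h⟩ | ⟨-, h⟩ <;>
    rw [h]
  · rw [Finset.card_map]; exact hC i
  · exact Finset.card_pair (Fin.castSucc_ne_last a)
  · exact Finset.card_pair (Fin.castSucc_ne_last b).symm

/-- Every bond lies inside the old sites `A = univ.erase ℓ` or inside
`B = insert a' (insert b' Aᶜ)`. [folklore] -/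
theorem spSub_sides {n m : ℕ} (C : Fin m → Finset (Fin n)) (i₀ : Fin m) (a b : Fin n)
    (C' : Fin (m + 1) → Finset (Fin (n + 1)))
    (hC'1 : ∀ i : Fin m, i ≠ i₀ → C' i.castSucc = (C i).map Fin.castSuccEmb)
    (hC'2 : C' i₀.castSucc = {a.castSucc, Fin.last n})
    (hC'3 : C' (Fin.last m) = {Fin.last n, b.castSucc}) (j : Fin (m + 1)) :
    C' j ⊆ Finset.univ.erase (Fin.last n) ∨
      C' j ⊆ insert a.castSucc (insert b.castSucc (Finset.univ.erase (Fin.last n))ᶜ) := by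
  rcases spSub_bond_cases C i₀ a b C' hC'1 hC'2 hC'3 j with ⟨i, -, -, h⟩ | ⟨-, h⟩ | ⟨-, h⟩ <;>
    rw [h]
  · left
    intro z hz
    rw [Finset.mem_erase]
    exact ⟨fun h => spPend_last_not_mem_map (C i) (h ▸ hz), Finset.mem_univ _⟩
  · right
    intro z hz
    simp only [Finset.mem_insert, Finset.mem_singleton] at hz
    rcases hz with rfl | rfl <;> simp
  · right
    intro z hz
    simp only [Finset.mem_insert, Finset.mem_singleton] at hz
    rcases hz with rfl | rfl <;> simp

/-- The bonds inside `B = {a', b', ℓ}` are `{a', b'}` (the old bonds parallel to `i₀`),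
`{a', ℓ}` or `{ℓ, b'}`. [folklore] -/
theorem spSub_bond_in_B {n m : ℕ} (C : Fin m → Finset (Fin n)) (hC : ∀ i, (C i).card = 2)
    (i₀ : Fin m) (a b : Fin n) (hab : a ≠ b) (C' : Fin (m + 1) → Finset (Fin (n + 1)))
    (hC'1 : ∀ i : Fin m, i ≠ i₀ → C' i.castSucc = (C i).map Fin.castSuccEmb)
    (hC'2 : C' i₀.castSucc = {a.castSucc, Fin.last n})
    (hC'3 : C' (Fin.last m) = {Fin.last n, b.castSucc}) (j : Fin (m + 1))
    (hj : C' j ⊆ insert a.castSucc (insert b.castSucc (Finset.univ.erase (Fin.last n))ᶜ)) :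
    C' j = {a.castSucc, b.castSucc} ∨ C' j = {a.castSucc, Fin.last n} ∨
      C' j = {Fin.last n, b.castSucc} := by
  rcases spSub_bond_cases C i₀ a b C' hC'1 hC'2 hC'3 j with ⟨i, -, -, h⟩ | ⟨-, h⟩ | ⟨-, h⟩
  · left
    rw [h] at hj ⊢
    rw [← spPend_map_pair]
    congr 1
    -- `C i ⊆ {a, b}` and both have two elements
    refine Finset.eq_of_subset_of_card_le (fun r hr => ?_) (by rw [Finset.card_pair hab, hC i])
    have hm : r.castSucc ∈ insert a.castSucc (insert b.castSucc (Finset.univ.erase (Fin.last n))ᶜ) :=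
      hj (Finset.mem_map_of_mem _ hr)
    simp only [Finset.mem_insert, Finset.mem_compl, Finset.mem_erase, Finset.mem_univ, and_true,
      not_not, Fin.castSucc_inj] at hm
    rcases hm with hm | hm | hm
    · simp [hm]
    · simp [hm]
    · exact absurd hm (Fin.castSucc_ne_last r)
  · exact Or.inr (Or.inl h)
  · exact Or.inr (Or.inr h)

/-! ## Total couplings on the pairs -/

/-- The total coupling of the subdivided structure on a pair `e`, split along the three kinds of
bonds. [folklore] -/
theorem spSub_coupling_sum {n m : ℕ} (C : Fin m → Finset (Fin n)) (i₀ : Fin m) (a b : Fin n)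
    (C' : Fin (m + 1) → Finset (Fin (n + 1)))
    (hC'1 : ∀ i : Fin m, i ≠ i₀ → C' i.castSucc = (C i).map Fin.castSuccEmb)
    (hC'2 : C' i₀.castSucc = {a.castSucc, Fin.last n})
    (hC'3 : C' (Fin.last m) = {Fin.last n, b.castSucc}) (K' : Fin (m + 1) → ℝ)
    (e : Finset (Fin (n + 1))) :
    ∑ j ∈ Finset.univ.filter (fun j => C' j = e), K' j
      = (∑ i : Fin m, if i ≠ i₀ ∧ (C i).map Fin.castSuccEmb = e then K' i.castSucc else 0)
        + (if ({a.castSucc, Fin.last n} : Finset (Fin (n + 1))) = e then K' i₀.castSucc else 0)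
        + (if ({Fin.last n, b.castSucc} : Finset (Fin (n + 1))) = e then K' (Fin.last m) else 0) := by
  rw [Finset.sum_filter, Fin.sum_univ_castSucc, hC'3]
  congr 1
  have hterm : ∀ i : Fin m, (if C' i.castSucc = e then K' i.castSucc else 0)
      = (if i ≠ i₀ ∧ (C i).map Fin.castSuccEmb = e then K' i.castSucc else 0)
        + (if i = i₀ then (if ({a.castSucc, Fin.last n} : Finset (Fin (n + 1))) = e
            then K' i₀.castSucc else 0) else 0) := by
    intro i
    by_cases hi : i = i₀
    · subst hi
      rw [hC'2]
      simp
    · rw [hC'1 i hi]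
      simp [hi]
  rw [Finset.sum_congr rfl (fun i _ => hterm i), Finset.sum_add_distrib, Finset.sum_ite_eq']
  simp

/-- Total coupling of the subdivided structure on an OLD pair `{p', q'}`: the old bonds `≠ i₀`
with support `{p, q}`. [folklore] -/
theorem spSub_coupling_old {n m : ℕ} (C : Fin m → Finset (Fin n)) (i₀ : Fin m) (a b : Fin n)
    (C' : Fin (m + 1) → Finset (Fin (n + 1)))
    (hC'1 : ∀ i : Fin m, i ≠ i₀ → C' i.castSucc = (C i).map Fin.castSuccEmb)
    (hC'2 : C' i₀.castSucc = {a.castSucc, Fin.last n})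
    (hC'3 : C' (Fin.last m) = {Fin.last n, b.castSucc}) (K' : Fin (m + 1) → ℝ) (p q : Fin n) :
    ∑ j ∈ Finset.univ.filter (fun j => C' j = {p.castSucc, q.castSucc}), K' j
      = ∑ i : Fin m, if i ≠ i₀ ∧ C i = {p, q} then K' i.castSucc else 0 := by
  rw [spSub_coupling_sum C i₀ a b C' hC'1 hC'2 hC'3 K']
  have hl : Fin.last n ∉ ({p.castSucc, q.castSucc} : Finset (Fin (n + 1))) := by
    rw [← spPend_map_pair]
    exact spPend_last_not_mem_map _
  rw [if_neg (fun h => hl (by rw [← h]; simp)), if_neg (fun h => hl (by rw [← h]; simp)), add_zero,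
    add_zero]
  refine Finset.sum_congr rfl fun i _ => ?_
  rw [← spPend_map_pair]
  simp only [Finset.map_inj]  -- `map` is injective

/-- Total coupling on `{a', ℓ}`: only the bond `i₀.castSucc`. [folklore] -/
theorem spSub_coupling_al {n m : ℕ} (C : Fin m → Finset (Fin n)) (i₀ : Fin m) (a b : Fin n)
    (hab : a ≠ b) (C' : Fin (m + 1) → Finset (Fin (n + 1)))
    (hC'1 : ∀ i : Fin m, i ≠ i₀ → C' i.castSucc = (C i).map Fin.castSuccEmb)
    (hC'2 : C' i₀.castSucc = {a.castSucc, Fin.last n})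
    (hC'3 : C' (Fin.last m) = {Fin.last n, b.castSucc}) (K' : Fin (m + 1) → ℝ) :
    ∑ j ∈ Finset.univ.filter (fun j => C' j = {a.castSucc, Fin.last n}), K' j = K' i₀.castSucc := by
  rw [spSub_coupling_sum C i₀ a b C' hC'1 hC'2 hC'3 K', if_pos rfl]
  have hne : ({Fin.last n, b.castSucc} : Finset (Fin (n + 1))) ≠ {a.castSucc, Fin.last n} := by
    intro h
    have hm : b.castSucc ∈ ({a.castSucc, Fin.last n} : Finset (Fin (n + 1))) := by rw [← h]; simp
    simp only [Finset.mem_insert, Finset.mem_singleton, Fin.castSucc_inj] at hm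
    rcases hm with hm | hm
    · exact hab hm.symm
    · exact Fin.castSucc_ne_last b hm
  rw [if_neg hne, add_zero, Finset.sum_eq_zero (fun i _ => ?_), zero_add]
  rw [if_neg]
  rintro ⟨-, h⟩
  exact spPend_last_not_mem_map (C i) (by rw [h]; simp)

/-- Total coupling on `{ℓ, b'}`: only the new bond `Fin.last m`. [folklore] -/
theorem spSub_coupling_lb {n m : ℕ} (C : Fin m → Finset (Fin n)) (i₀ : Fin m) (a b : Fin n)
    (hab : a ≠ b) (C' : Fin (m + 1) → Finset (Fin (n + 1)))
    (hC'1 : ∀ i : Fin m, i ≠ i₀ → C' i.castSucc = (C i).map Fin.castSuccEmb)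
    (hC'2 : C' i₀.castSucc = {a.castSucc, Fin.last n})
    (hC'3 : C' (Fin.last m) = {Fin.last n, b.castSucc}) (K' : Fin (m + 1) → ℝ) :
    ∑ j ∈ Finset.univ.filter (fun j => C' j = {Fin.last n, b.castSucc}), K' j = K' (Fin.last m) := by
  rw [spSub_coupling_sum C i₀ a b C' hC'1 hC'2 hC'3 K', if_pos rfl]
  have hne : ({a.castSucc, Fin.last n} : Finset (Fin (n + 1))) ≠ {Fin.last n, b.castSucc} := by
    intro h
    have hm : a.castSucc ∈ ({Fin.last n, b.castSucc} : Finset (Fin (n + 1))) := by rw [← h]; simp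
    simp only [Finset.mem_insert, Finset.mem_singleton, Fin.castSucc_inj] at hm
    rcases hm with hm | hm
    · exact Fin.castSucc_ne_last a hm
    · exact hab hm
  rw [if_neg hne, add_zero, Finset.sum_eq_zero (fun i _ => ?_), zero_add]
  rw [if_neg]
  rintro ⟨-, h⟩
  exact spPend_last_not_mem_map (C i) (by rw [h]; simp)

/-- Total coupling of the OLD structure on `{p, q}` for the coupling vector "`K'' ` on `i₀`,
`K' i.castSucc` elsewhere". [folklore] -/
theorem spSub_coupling_Kvec {n m : ℕ} (C : Fin m → Finset (Fin n)) (i₀ : Fin m) (a b : Fin n)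
    (hCi₀ : C i₀ = {a, b}) (K' : Fin (m + 1) → ℝ) (Kpp : ℝ) (p q : Fin n) :
    ∑ i ∈ Finset.univ.filter (fun i => C i = {p, q}), (if i = i₀ then Kpp else K' i.castSucc)
      = (if ({a, b} : Finset (Fin n)) = {p, q} then Kpp else 0)
        + ∑ i : Fin m, if i ≠ i₀ ∧ C i = {p, q} then K' i.castSucc else 0 := by
  rw [Finset.sum_filter]
  have hterm : ∀ i : Fin m, (if C i = {p, q} then (if i = i₀ then Kpp else K' i.castSucc) else 0)
      = (if i = i₀ then (if ({a, b} : Finset (Fin n)) = {p, q} then Kpp else 0) else 0)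
        + (if i ≠ i₀ ∧ C i = {p, q} then K' i.castSucc else 0) := by
    intro i
    by_cases hi : i = i₀
    · subst hi
      rw [hCi₀]
      simp
    · simp [hi]
  rw [Finset.sum_congr rfl (fun i _ => hterm i), Finset.sum_add_distrib, Finset.sum_ite_eq']
  simp

/-! ## The marginal identity: summing out the new spin -/

/-- An embedded old spin of the configuration `snoc σ t`. [folklore] -/
theorem spSub_spinAt_snoc_castSucc {n : ℕ} (σ : SpinConfig (Fin n)) (t : ℤˣ) (r : Fin n) :
    spinAt r.castSucc (Fin.snoc (α := fun _ => ℤˣ) σ t) = spinAt r σ := by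
  simp only [spinAt, Fin.snoc_castSucc]

/-- The new spin of the configuration `snoc σ t` is `t`. [folklore] -/
theorem spSub_spinAt_snoc_last {n : ℕ} (σ : SpinConfig (Fin n)) (t : ℤˣ) :
    spinAt (Fin.last n) (Fin.snoc (α := fun _ => ℤˣ) σ t) = ((t : ℤ) : ℝ) := by
  simp only [spinAt, Fin.snoc_last]

/-- An embedded old support reads the old spins of `snoc σ t`. [folklore] -/
theorem spSub_spinProduct_map_snoc {n : ℕ} (s : Finset (Fin n)) (σ : SpinConfig (Fin n)) (t : ℤˣ) :
    spinProduct (s.map Fin.castSuccEmb) (Fin.snoc (α := fun _ => ℤˣ) σ t) = spinProduct s σ := by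
  unfold spinProduct
  rw [Finset.prod_map]
  exact Finset.prod_congr rfl fun r _ => spSub_spinAt_snoc_castSucc σ t r

/-- The Hamiltonian of the subdivided system at `snoc σ t`:
`∑_{i ≠ i₀} K'_i σ_{C i} + t (u σ_a + w σ_b)`. [folklore] -/
theorem spSub_ham_snoc {n m : ℕ} (C : Fin m → Finset (Fin n)) (i₀ : Fin m) (a b : Fin n)
    (C' : Fin (m + 1) → Finset (Fin (n + 1)))
    (hC'1 : ∀ i : Fin m, i ≠ i₀ → C' i.castSucc = (C i).map Fin.castSuccEmb)
    (hC'2 : C' i₀.castSucc = {a.castSucc, Fin.last n})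
    (hC'3 : C' (Fin.last m) = {Fin.last n, b.castSucc}) (K' : Fin (m + 1) → ℝ)
    (σ : SpinConfig (Fin n)) (t : ℤˣ) :
    gksHamiltonian Finset.univ K' C' (Fin.snoc (α := fun _ => ℤˣ) σ t)
      = (∑ i : Fin m, if i = i₀ then 0 else K' i.castSucc * spinProduct (C i) σ)
        + ((t : ℤ) : ℝ) * (K' i₀.castSucc * spinAt a σ + K' (Fin.last m) * spinAt b σ) := by
  unfold gksHamiltonian
  rw [Fin.sum_univ_castSucc, hC'3, c2_spinProduct_pair (Fin.castSucc_ne_last b).symm,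
    spSub_spinAt_snoc_last, spSub_spinAt_snoc_castSucc]
  have hterm : ∀ i : Fin m, K' i.castSucc * spinProduct (C' i.castSucc) (Fin.snoc (α := fun _ => ℤˣ) σ t)
      = (if i = i₀ then 0 else K' i.castSucc * spinProduct (C i) σ)
        + (if i = i₀ then K' i₀.castSucc * (spinAt a σ * ((t : ℤ) : ℝ)) else 0) := by
    intro i
    by_cases hi : i = i₀
    · subst hi
      rw [hC'2, c2_spinProduct_pair (Fin.castSucc_ne_last a), spSub_spinAt_snoc_last,
        spSub_spinAt_snoc_castSucc, if_pos rfl, if_pos rfl, zero_add]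
    · rw [hC'1 i hi, spSub_spinProduct_map_snoc, if_neg hi, if_neg hi, add_zero]
  rw [Finset.sum_congr rfl (fun i _ => hterm i), Finset.sum_add_distrib, Finset.sum_ite_eq']
  simp only [Finset.mem_univ, if_true]
  ring

/-- The Hamiltonian of the old structure with `K''` on `i₀`:
`∑_{i ≠ i₀} K'_i σ_{C i} + K'' σ_aσ_b`. [folklore] -/
theorem spSub_ham_old {n m : ℕ} (C : Fin m → Finset (Fin n)) (i₀ : Fin m) (a b : Fin n)
    (hab : a ≠ b) (hCi₀ : C i₀ = {a, b}) (K' : Fin (m + 1) → ℝ) (Kpp : ℝ) (σ : SpinConfig (Fin n)) :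
    gksHamiltonian Finset.univ (fun i => if i = i₀ then Kpp else K' i.castSucc) C σ
      = (∑ i : Fin m, if i = i₀ then 0 else K' i.castSucc * spinProduct (C i) σ)
        + Kpp * (spinAt a σ * spinAt b σ) := by
  unfold gksHamiltonian
  have hterm : ∀ i : Fin m, (if i = i₀ then Kpp else K' i.castSucc) * spinProduct (C i) σ
      = (if i = i₀ then 0 else K' i.castSucc * spinProduct (C i) σ)
        + (if i = i₀ then Kpp * (spinAt a σ * spinAt b σ) else 0) := by
    intro i
    by_cases hi : i = i₀
    · subst hi
      rw [hCi₀, c2_spinProduct_pair hab, if_pos rfl, if_pos rfl, if_pos rfl, zero_add]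
    · rw [if_neg hi, if_neg hi, if_neg hi, add_zero]
  rw [Finset.sum_congr rfl (fun i _ => hterm i), Finset.sum_add_distrib, Finset.sum_ite_eq']
  simp only [Finset.mem_univ, if_true]

/-- **Summing out the new spin** `σ_ℓ = t`:
`∑_{t = ±1} w'(snoc σ t) = 2 cosh (u+w) e^{−K''} · w_{K''}(σ)` (`u = K' i₀.castSucc`,
`w = K' (Fin.last m)`, `K'' = ½ log (cosh (u+w)/cosh (u−w))` on `i₀`). [folklore] -/
theorem spSub_sum_weight_snoc {n m : ℕ} (C : Fin m → Finset (Fin n)) (i₀ : Fin m) (a b : Fin n)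
    (hab : a ≠ b) (hCi₀ : C i₀ = {a, b}) (C' : Fin (m + 1) → Finset (Fin (n + 1)))
    (hC'1 : ∀ i : Fin m, i ≠ i₀ → C' i.castSucc = (C i).map Fin.castSuccEmb)
    (hC'2 : C' i₀.castSucc = {a.castSucc, Fin.last n})
    (hC'3 : C' (Fin.last m) = {Fin.last n, b.castSucc}) (K' : Fin (m + 1) → ℝ) (Kpp : ℝ)
    (hKpp : Kpp = Real.log (Real.cosh (K' i₀.castSucc + K' (Fin.last m))
      / Real.cosh (K' i₀.castSucc - K' (Fin.last m))) / 2)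
    (σ : SpinConfig (Fin n)) :
    ∑ t : ℤˣ, gksWeight Finset.univ K' C' (Fin.snoc (α := fun _ => ℤˣ) σ t)
      = 2 * (Real.cosh (K' i₀.castSucc + K' (Fin.last m)) * Real.exp (-Kpp))
        * gksWeight Finset.univ (fun i => if i = i₀ then Kpp else K' i.castSucc) C σ := by
  unfold gksWeight
  rw [spSub_ham_old C i₀ a b hab hCi₀ K' Kpp σ, UnitsInt.univ,
    Finset.sum_pair (by decide : (1 : ℤˣ) ≠ -1),
    spSub_ham_snoc C i₀ a b C' hC'1 hC'2 hC'3 K' σ 1, spSub_ham_snoc C i₀ a b C' hC'1 hC'2 hC'3 K' σ (-1)]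
  simp only [Units.val_one, Units.val_neg, Int.cast_one, Int.cast_neg, one_mul, neg_one_mul]
  rw [show ∀ R h : ℝ, Real.exp (R + h) + Real.exp (R + -h) = Real.exp R * (2 * Real.cosh h) from
      fun R h => by rw [Real.exp_add, Real.exp_add, Real.cosh_eq]; ring,
    spSub_cosh_two_spins _ _ _ _ (spinAt_eq_one_or_eq_neg_one a σ)
      (spinAt_eq_one_or_eq_neg_one b σ), ← hKpp, Real.exp_add]
  ring

/-- **Marginal identity, unnormalised**: for every observable `G` of the old spins,
`Z'⟨G⟩' = 2 cosh (u+w) e^{−K''} · Z_{K''}⟨G⟩_{K''}`. [folklore] -/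
theorem spSub_gksSum_marginal {n m : ℕ} (C : Fin m → Finset (Fin n)) (i₀ : Fin m) (a b : Fin n)
    (hab : a ≠ b) (hCi₀ : C i₀ = {a, b}) (C' : Fin (m + 1) → Finset (Fin (n + 1)))
    (hC'1 : ∀ i : Fin m, i ≠ i₀ → C' i.castSucc = (C i).map Fin.castSuccEmb)
    (hC'2 : C' i₀.castSucc = {a.castSucc, Fin.last n})
    (hC'3 : C' (Fin.last m) = {Fin.last n, b.castSucc}) (K' : Fin (m + 1) → ℝ) (Kpp : ℝ)
    (hKpp : Kpp = Real.log (Real.cosh (K' i₀.castSucc + K' (Fin.last m))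
      / Real.cosh (K' i₀.castSucc - K' (Fin.last m))) / 2)
    (G : SpinConfig (Fin n) → ℝ) :
    gksSum Finset.univ K' C' (fun ω => G (fun r => ω r.castSucc))
      = 2 * (Real.cosh (K' i₀.castSucc + K' (Fin.last m)) * Real.exp (-Kpp))
        * gksSum Finset.univ (fun i => if i = i₀ then Kpp else K' i.castSucc) C G := by
  unfold gksSum
  rw [← Fintype.sum_equiv (Fin.snocEquiv fun _ => ℤˣ)
    (fun x => G x.2 * gksWeight Finset.univ K' C' (Fin.snoc (α := fun _ => ℤˣ) x.2 x.1))
    (fun ω => G (fun r => ω r.castSucc) * gksWeight Finset.univ K' C' ω)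
    (fun x => by simp only [Fin.snocEquiv_apply, Fin.snoc_castSucc]; rfl)]
  rw [Fintype.sum_prod_type, Finset.sum_comm, Finset.mul_sum]
  refine Finset.sum_congr rfl fun σ _ => ?_
  dsimp only
  rw [← Finset.mul_sum, spSub_sum_weight_snoc C i₀ a b hab hCi₀ C' hC'1 hC'2 hC'3 K' Kpp hKpp σ]
  ring

/-- **Marginal identity**: the law of the old spins under the subdivided system (couplings `K'`)
is the old system with `K' i.castSucc` off `i₀` and the series coupling `K''` on `i₀`. [folklore] -/
theorem spSub_marginal {n m : ℕ} (C : Fin m → Finset (Fin n)) (i₀ : Fin m) (a b : Fin n)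
    (hab : a ≠ b) (hCi₀ : C i₀ = {a, b}) (C' : Fin (m + 1) → Finset (Fin (n + 1)))
    (hC'1 : ∀ i : Fin m, i ≠ i₀ → C' i.castSucc = (C i).map Fin.castSuccEmb)
    (hC'2 : C' i₀.castSucc = {a.castSucc, Fin.last n})
    (hC'3 : C' (Fin.last m) = {Fin.last n, b.castSucc}) (K' : Fin (m + 1) → ℝ) (Kpp : ℝ)
    (hKpp : Kpp = Real.log (Real.cosh (K' i₀.castSucc + K' (Fin.last m))
      / Real.cosh (K' i₀.castSucc - K' (Fin.last m))) / 2)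
    (F : SpinConfig (Fin n) → ℝ) :
    gksExpect Finset.univ K' C' (fun ω => F (fun r => ω r.castSucc))
      = gksExpect Finset.univ (fun i => if i = i₀ then Kpp else K' i.castSucc) C F := by
  have hc : 2 * (Real.cosh (K' i₀.castSucc + K' (Fin.last m)) * Real.exp (-Kpp)) ≠ 0 :=
    mul_ne_zero two_ne_zero (mul_pos (Real.cosh_pos _) (Real.exp_pos _)).ne'
  have h1 := spSub_gksSum_marginal C i₀ a b hab hCi₀ C' hC'1 hC'2 hC'3 K' Kpp hKpp (fun _ => 1)
  unfold gksExpect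
  rw [spSub_gksSum_marginal C i₀ a b hab hCi₀ C' hC'1 hC'2 hC'3 K' Kpp hKpp F, h1,
    mul_div_mul_left _ _ hc]

/-- Registered helper `helper_spSub_marginal` (representative of this auxiliary file): the marginal
identity of the subdivided structure — summing out the new spin gives the old structure with the
series coupling `½ log (cosh (u+w)/cosh (u−w))` on `i₀` (`spSub_marginal`). [folklore] -/
theorem helper_spSub_marginal : ∀ (n m : ℕ) (C : Fin m → Finset (Fin n)) (i₀ : Fin m) (a b : Fin n), a ≠ b → C i₀ = {a, b} → ∀ (C' : Fin (m + 1) → Finset (Fin (n + 1))), (∀ i : Fin m, i ≠ i₀ → C' i.castSucc = (C i).map Fin.castSuccEmb) → C' i₀.castSucc = {a.castSucc, Fin.last n} → C' (Fin.last m) = {Fin.last n, b.castSucc} → ∀ (K' : Fin (m + 1) → ℝ) (F : SpinConfig (Fin n) → ℝ), gksExpect Finset.univ K' C' (fun ω => F (fun r => ω r.castSucc)) = gksExpect Finset.univ (fun i => if i = i₀ then Real.log (Real.cosh (K' i₀.castSucc + K' (Fin.last m)) / Real.cosh (K' i₀.castSucc - K' (Fin.last m))) / 2 else K' i.castSucc)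 C F :=
  fun _ _ C i₀ a b hab hCi₀ C' hC'1 hC'2 hC'3 K' F =>
    spSub_marginal C i₀ a b hab hCi₀ C' hC'1 hC'2 hC'3 K' _ rfl F

end Summit.CriticalPhenomena.Ising3DConformalLimit.Cruxes.InverseMFerromagnet.PartialCovarianceLadder
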